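import Literature.Analysis.Calculus.SardProofs
import Mathlib.Geometry.Manifold.MFDeriv.Atlas
import Mathlib.Geometry.Manifold.MFDeriv.NormedSpace
import Mathlib.Geometry.Manifold.ContMDiff.Atlas
import Mathlib.Geometry.Manifold.Instances.Real
import Mathlib.MeasureTheory.Measure.Haar.InnerProductSpace
import HarnessLib

/-!
# Regular values of real functions on manifolds exist in every interval (Sard, `n = 1`)

General differential topology (Milnor, *Topology from the Differentiable Viewpoint* (1965), §2–§3:
"the set of regular values of a smooth map `f : M → N` is everywhere dense in `N`", Brown's
corollary of Sard's theorem), in the real-valued form consumed by level-set constructions: for a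
`C^∞` function `u : M → ℝ` on a `C^∞` manifold modelled on `ℝᵐ` and a compact set `C ⊆ M`,
every nonempty open interval contains a value `s` which is not a critical value of `u` on `C`
(`u x = s`, `x ∈ C` imply `du_x ≠ 0`).  From the tree's Sard theorem
`Literature.Analysis.Calculus.sard_holds` (maps between Euclidean spaces on open sets) read in
finitely many charts covering `C`:

* `volume_image_critical_chart_eq_zero` — in one extended chart `φ` at `x₀`, the set of values of
  `u` at critical points of the chart source is Lebesgue-null (Sard for
  `u ∘ φ⁻¹ : ℝᵐ ⊇ φ.target → ℝ`, `ℝ` identified with `ℝ¹` by a measure-preserving linear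
  isometry);
* `volume_setOf_critical_isCompact_eq_zero` — the critical values on a compact set are null;
* `exists_mem_Ioo_forall_mfderiv_ne_zero` — **a non-critical value in every interval**.

Everything is proved; no definitions, no named facts.

## References

* J. Milnor, *Topology from the Differentiable Viewpoint* (1965), §2, §3 (Theorem of Sard and
  Brown's corollary, pp. 10–11, 16–17). [MilnorTDV1965]
-/

noncomputable section

open Set Function MeasureTheory Filter
open scoped Manifold ContDiff Topology

namespace Literature.Geometry.Manifold

/-- Local notation: `𝔼 n` is the model Euclidean space `EuclideanSpace ℝ (Fin n)`. -/
local notation "𝔼 " n:arg => EuclideanSpace ℝ (Fin n)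

/-! ### `ℝ` as `ℝ¹` -/

/-- The identification `ℝ ≃L ℝ¹`, `r ↦ (r)`. [folklore] -/
def toE1 : ℝ ≃L[ℝ] 𝔼 1 :=
  ((EuclideanSpace.equiv (Fin 1) ℝ).trans (ContinuousLinearEquiv.funUnique (Fin 1) ℝ ℝ)).symm

/-- `toE1 r = toLp 2 (fun _ => r)`. [folklore] -/
theorem toE1_apply (r : ℝ) : toE1 r = WithLp.toLp 2 (fun _ : Fin 1 => r) := rfl

/-- The same identification as a measurable equivalence. [folklore] -/
def toE1m : ℝ ≃ᵐ 𝔼 1 :=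
  (MeasurableEquiv.funUnique (Fin 1) ℝ).symm.trans (MeasurableEquiv.toLp 2 (Fin 1 → ℝ))

/-- `toE1m = toE1` as functions. [folklore] -/
theorem toE1m_apply (r : ℝ) : toE1m r = toE1 r := rfl

/-- `toE1` preserves Lebesgue measure. [folklore] -/
theorem measurePreserving_toE1m : MeasurePreserving toE1m volume volume :=
  ((volume_preserving_funUnique (Fin 1) ℝ).symm _).trans (PiLp.volume_preserving_toLp (Fin 1))

/-- Images under `toE1` have the same Lebesgue measure. [folklore] -/
theorem volume_image_toE1 (A : Set ℝ) : volume (toE1 '' A) = volume A := by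
  have h1 : toE1 '' A = toE1m '' A := by
    ext x; simp only [mem_image, toE1m_apply]
  rw [h1, MeasurableEquiv.image_eq_preimage_symm, ← MeasurableEquiv.map_apply toE1m.symm,
    ← measurePreserving_toE1m.symm.map_eq]

/-- A real linear functional is surjective iff it is nonzero. [folklore] -/
theorem surjective_iff_ne_zero {E : Type*} [AddCommGroup E] [Module ℝ E] [TopologicalSpace E]
    (L : E →L[ℝ] ℝ) : Surjective L ↔ L ≠ 0 := by
  constructor
  · rintro h rfl
    obtain ⟨x, hx⟩ := h 1
    simp at hx
  · intro h r
    obtain ⟨x, hx⟩ : ∃ x, L x ≠ 0 := by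
      by_contra hcon
      push Not at hcon
      exact h (ContinuousLinearMap.ext hcon)
    refine ⟨(r / L x) • x, ?_⟩
    rw [map_smul, smul_eq_mul, div_mul_cancel₀ r hx]

/-! ### Critical values in a chart -/

variable {m : ℕ} {M : Type*} [TopologicalSpace M] [ChartedSpace (𝔼 m) M]
  [IsManifold (𝓡 m) ∞ M] {u : M → ℝ}

/-- **Critical values over one chart are null.**  For `C^∞` `u : M → ℝ` and `x₀ ∈ M`, the set
of values `u x` at points `x` of the source of the extended chart at `x₀` with `du_x = 0` has
Lebesgue measure zero: it is the set of critical values of `u ∘ φ⁻¹` on the open set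
`φ.target ⊆ ℝᵐ` (Sard's theorem `Literature.Analysis.Calculus.sard_holds`, read through
`ℝ ≃ ℝ¹`). [cite: MilnorTDV1965, §3, Theorem p. 16] -/
theorem volume_image_critical_chart_eq_zero (hu : ContMDiff (𝓡 m) 𝓘(ℝ, ℝ) ∞ u) (x₀ : M) :
    volume {s : ℝ | ∃ x ∈ (extChartAt (𝓡 m) x₀).source,
      u x = s ∧ mfderiv (𝓡 m) 𝓘(ℝ, ℝ) u x = 0} = 0 := by
  set φ := extChartAt (𝓡 m) x₀ with hφ
  set g : (𝔼 m) → ℝ := u ∘ φ.symm with hg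
  set f : (𝔼 m) → 𝔼 1 := toE1 ∘ g with hf
  have hUo : IsOpen φ.target := isOpen_extChartAt_target x₀
  -- smoothness of `g` and `f` on the target
  have hgs : ContMDiffOn 𝓘(ℝ, 𝔼 m) 𝓘(ℝ, ℝ) ∞ g φ.target :=
    hu.comp_contMDiffOn (contMDiffOn_extChartAt_symm x₀)
  have hgs' : ContDiffOn ℝ ∞ g φ.target := contMDiffOn_iff_contDiffOn.1 hgs
  have hfs : ContDiffOn ℝ ∞ f φ.target := toE1.contDiff.comp_contDiffOn hgs'
  -- Sard for `f`
  have hS := Literature.Analysis.Calculus.sard_holds f φ.target hUo hfs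
  -- the critical values of `u` over the chart are critical values of `g`
  have hsub : {s : ℝ | ∃ x ∈ φ.source, u x = s ∧ mfderiv (𝓡 m) 𝓘(ℝ, ℝ) u x = 0} ⊆
      g '' {z ∈ φ.target | ¬ Surjective (fderiv ℝ f z)} := by
    rintro s ⟨x, hx, rfl, hdx⟩
    refine ⟨φ x, ⟨φ.map_source hx, ?_⟩, ?_⟩
    · -- `Df = toE1 ∘ Dg` and `Dg (φ x) = du_x ∘ D(φ⁻¹) = 0`
      have hz : φ x ∈ φ.target := φ.map_source hx
      have hgd : MDifferentiableAt 𝓘(ℝ, 𝔼 m) 𝓘(ℝ, ℝ) g (φ x) :=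
        (hgs.mdifferentiableOn (by simp) _ hz).mdifferentiableAt (hUo.mem_nhds hz)
      have hsymm : MDifferentiableAt 𝓘(ℝ, 𝔼 m) (𝓡 m) φ.symm (φ x) :=
        ((contMDiffOn_extChartAt_symm (n := ∞) x₀).mdifferentiableOn (by simp) _ hz).mdifferentiableAt
          (hUo.mem_nhds hz)
      have hux : MDifferentiableAt (𝓡 m) 𝓘(ℝ, ℝ) u (φ.symm (φ x)) :=
        hu.mdifferentiableAt (by simp)
      have hcomp := mfderiv_comp (φ x) hux hsymm
      have hg0 : mfderiv 𝓘(ℝ, 𝔼 m) 𝓘(ℝ, ℝ) g (φ x) = 0 := by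
        rw [hg, hcomp, φ.left_inv hx, hdx, ContinuousLinearMap.zero_comp]
        rfl
      have hfd0 : fderiv ℝ g (φ x) = 0 := by
        rw [← mfderiv_eq_fderiv, hg0]
        rfl
      have hgdiff : DifferentiableAt ℝ g (φ x) := hgd.differentiableAt
      have hfd : fderiv ℝ f (φ x) = (toE1 : ℝ →L[ℝ] 𝔼 1).comp (fderiv ℝ g (φ x)) := by
        rw [hf]
        exact (toE1 : ℝ →L[ℝ] 𝔼 1).fderiv.symm ▸ fderiv_comp (φ x) toE1.differentiableAt hgdiff
      rw [hfd, hfd0, ContinuousLinearMap.comp_zero]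
      intro hsurj
      obtain ⟨v, hv⟩ := hsurj (toE1 1)
      simp at hv
      exact one_ne_zero (toE1.injective (by simpa using hv.symm))
    · show u (φ.symm (φ x)) = u x
      rw [φ.left_inv hx]
  -- transfer nullity along `toE1`
  have hnull : volume (g '' {z ∈ φ.target | ¬ Surjective (fderiv ℝ f z)}) = 0 := by
    rw [← volume_image_toE1, ← image_comp]
    exact hS
  exact measure_mono_null hsub hnull

/-- **The critical values of a smooth real function on a compact set are Lebesgue-null**
(finitely many charts). [cite: MilnorTDV1965, §3, Theorem p. 16] -/
theorem volume_setOf_critical_isCompact_eq_zero (hu : ContMDiff (𝓡 m) 𝓘(ℝ, ℝ) ∞ u)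
    {C : Set M} (hC : IsCompact C) :
    volume {s : ℝ | ∃ x ∈ C, u x = s ∧ mfderiv (𝓡 m) 𝓘(ℝ, ℝ) u x = 0} = 0 := by
  obtain ⟨t, -, htC⟩ := hC.elim_nhds_subcover (fun x => (extChartAt (𝓡 m) x).source)
    fun x _ => extChartAt_source_mem_nhds (I := 𝓡 m) x
  have hsub : {s : ℝ | ∃ x ∈ C, u x = s ∧ mfderiv (𝓡 m) 𝓘(ℝ, ℝ) u x = 0} ⊆
      ⋃ x₀ ∈ t, {s : ℝ | ∃ x ∈ (extChartAt (𝓡 m) x₀).source,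
        u x = s ∧ mfderiv (𝓡 m) 𝓘(ℝ, ℝ) u x = 0} := by
    rintro s ⟨x, hx, hs, hdx⟩
    obtain ⟨x₀, hx₀, hx'⟩ := mem_iUnion₂.1 (htC hx)
    exact mem_iUnion₂.2 ⟨x₀, hx₀, x, hx', hs, hdx⟩
  refine measure_mono_null hsub ?_
  exact (measure_biUnion_null_iff t.countable_toSet).2 fun x₀ _ =>
    volume_image_critical_chart_eq_zero hu x₀

/-- **A non-critical value in every interval** (Brown's corollary of Sard's theorem, Milnor
(1965), §3, p. 17: the regular values are dense): for `C^∞` `u : M → ℝ`, compact `C ⊆ M` and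
`a < b` there is `s ∈ (a, b)` such that `du_x ≠ 0` at every `x ∈ C` with `u x = s`.
[cite: MilnorTDV1965, §3, Corollary (Brown) p. 17] -/
theorem exists_mem_Ioo_forall_mfderiv_ne_zero (hu : ContMDiff (𝓡 m) 𝓘(ℝ, ℝ) ∞ u)
    {C : Set M} (hC : IsCompact C) {a b : ℝ} (hab : a < b) :
    ∃ s ∈ Ioo a b, ∀ x ∈ C, u x = s → mfderiv (𝓡 m) 𝓘(ℝ, ℝ) u x ≠ 0 := by
  by_contra hcon
  push Not at hcon
  have hsub : Ioo a b ⊆ {s : ℝ | ∃ x ∈ C, u x = s ∧ mfderiv (𝓡 m) 𝓘(ℝ, ℝ) u x = 0} := by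
    intro s hs
    obtain ⟨x, hx, hux, hdx⟩ := hcon s hs
    exact ⟨x, hx, hux, hdx⟩
  have h0 := measure_mono_null hsub (volume_setOf_critical_isCompact_eq_zero hu hC)
  rw [Real.volume_Ioo] at h0
  have : (0 : ENNReal) < ENNReal.ofReal (b - a) := ENNReal.ofReal_pos.2 (by linarith)
  exact this.ne' h0

end Literature.Geometry.Manifold
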